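import Mathlib

/-!
# OneSphereInfluenceHardCorePoincareDobrushinOscillation — Abstract Dobrushin theory I:
oscillations, the TV lemma, one-site operators, contraction

This file is part 4/9 of the DobrushinDoor chain proving the crux
`OneSphereInfluence.HardCorePoincare` (stmt-AtomisticToContinuum-13619) sorry-free; the closing
theorem `hardCorePoincare_holds` and the full account are in
`OneSphereInfluenceHardCorePoincareDobrushin.lean` (part 9/9). decomp-a2c · lens-1 · g39.

CONTENTS. Model-free (Mathlib only). One-site operators `siteOp`, random scan `scanOp`, coordinate
oscillations `osc`, total oscillation `Phi`, `hybrid` configurations; the layer-cake total-variation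
lemma `|∫ h dp − ∫ h dq| ≤ osc(h)·c`; boundedness / measurability / locality of `siteOp`;
Dobrushin`s one-step comparison `osc_siteOp_le` and the CONTRACTION `Phi_scanOp_le : Φ(T f) ≤
((n+D)/(n+1)) Φ f` (row sums only).
-/

open MeasureTheory ProbabilityTheory Set Function
open scoped ENNReal

noncomputable section

namespace Summit.AtomisticToContinuum.HydrodynamicLimit.Theorems.HardCorePoincareDobrushin.Abstract

variable {n : ℕ} {E : Type} [MeasurableSpace E]

/-- The one-site heat-bath operator `P_i f (z) = ∫ f (update z i y) d(K i z)`. -/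
def siteOp (K : Fin (n + 1) → Kernel (Fin (n + 1) → E) E) (i : Fin (n + 1))
    (f : (Fin (n + 1) → E) → ℝ) : (Fin (n + 1) → E) → ℝ :=
  fun z => ∫ y, f (update z i y) ∂(K i z)

/-- The random-scan operator `T f = (n+1)⁻¹ Σ_i P_i f`. -/
def scanOp (K : Fin (n + 1) → Kernel (Fin (n + 1) → E) E) (f : (Fin (n + 1) → E) → ℝ) :
    (Fin (n + 1) → E) → ℝ :=
  fun z => ((n : ℝ) + 1)⁻¹ * ∑ i, siteOp K i f z

/-- The oscillation of `f` in coordinate `j`. -/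
def osc (j : Fin (n + 1)) (f : (Fin (n + 1) → E) → ℝ) : ℝ :=
  ⨆ p : (Fin (n + 1) → E) × E × E, |f (update p.1 j p.2.1) - f (update p.1 j p.2.2)|

/-- Total oscillation `Φ f = Σ_j osc_j f`. -/
def Phi (f : (Fin (n + 1) → E) → ℝ) : ℝ := ∑ j, osc j f

/-! ### Oscillation API -/

omit [MeasurableSpace E] in
/-- The oscillation of `f` in coordinate `j` is nonnegative. -/
theorem osc_nonneg (j : Fin (n + 1)) (f : (Fin (n + 1) → E) → ℝ) : 0 ≤ osc j f :=
  Real.iSup_nonneg fun _ => abs_nonneg _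

omit [MeasurableSpace E] in
/-- A uniform bound on coordinate-`j` increments of `f` bounds its oscillation `osc j f`. -/
theorem osc_le {j : Fin (n + 1)} {f : (Fin (n + 1) → E) → ℝ} {a : ℝ} (ha : 0 ≤ a)
    (h : ∀ (z : Fin (n + 1) → E) (y y' : E), |f (update z j y) - f (update z j y')| ≤ a) :
    osc j f ≤ a :=
  Real.iSup_le (fun p => h p.1 p.2.1 p.2.2) ha

omit [MeasurableSpace E] in
/-- For bounded `f`, every coordinate-`j` increment is bounded by the oscillation `osc j f`. -/
theorem abs_sub_le_osc {f : (Fin (n + 1) → E) → ℝ} {M : ℝ} (hfM : ∀ z, |f z| ≤ M)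
    (j : Fin (n + 1)) (z : Fin (n + 1) → E) (y y' : E) :
    |f (update z j y) - f (update z j y')| ≤ osc j f := by
  have hb : BddAbove (Set.range fun p : (Fin (n + 1) → E) × E × E =>
      |f (update p.1 j p.2.1) - f (update p.1 j p.2.2)|) := by
    refine ⟨M + M, ?_⟩
    rintro _ ⟨p, rfl⟩
    have h1 := hfM (update p.1 j p.2.1)
    have h2 := hfM (update p.1 j p.2.2)
    have h3 := abs_sub (f (update p.1 j p.2.1)) (f (update p.1 j p.2.2))
    simp only [abs_le] at h1 h2 ⊢
    constructor <;> linarith [h1.1, h1.2, h2.1, h2.2, abs_nonneg (f (update p.1 j p.2.1) - f (update p.1 j p.2.2)), h3]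
  exact le_ciSup hb (⟨z, y, y'⟩ : (Fin (n + 1) → E) × E × E)


/-! ### The total-variation lemma `|∫ h dp − ∫ h dq| ≤ osc(h) · TV(p,q)` -/

omit [MeasurableSpace E] in
/-- If `g ≤ 1` everywhere then the super-level set `{t < g}` is empty for `t ≥ 1`. -/
theorem setOf_lt_eq_empty {g : E → ℝ} (hg1 : ∀ w, g w ≤ 1) {t : ℝ} (ht : 1 ≤ t) :
    {a : E | t < g a} = ∅ :=
  Set.eq_empty_iff_forall_notMem.2 fun a h => (lt_irrefl t) (h.trans_le ((hg1 a).trans ht))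

/-- Layer-cake bound: a total-variation estimate `p A ≤ q A + c` transfers to lower integrals of `[0,1]`-valued functions. -/
theorem lintegral_le_of_tv {p q : Measure E} [IsFiniteMeasure p] [IsFiniteMeasure q] {c : ℝ}
    (hc0 : 0 ≤ c) (hc : ∀ A, MeasurableSet A → (p A).toReal ≤ (q A).toReal + c)
    {g : E → ℝ} (hg : Measurable g) (hg0 : ∀ w, 0 ≤ g w) (hg1 : ∀ w, g w ≤ 1) :
    ∫⁻ w, ENNReal.ofReal (g w) ∂p ≤ ∫⁻ w, ENNReal.ofReal (g w) ∂q + ENNReal.ofReal c := by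
  have hA : ∀ A, MeasurableSet A → p A ≤ q A + ENNReal.ofReal c := by
    intro A hA
    rw [← ENNReal.ofReal_toReal (measure_ne_top p A), ← ENNReal.ofReal_toReal (measure_ne_top q A),
      ← ENNReal.ofReal_add ENNReal.toReal_nonneg hc0]
    exact ENNReal.ofReal_le_ofReal (hc A hA)
  rw [lintegral_eq_lintegral_meas_lt p (Filter.Eventually.of_forall hg0) hg.aemeasurable,
    lintegral_eq_lintegral_meas_lt q (Filter.Eventually.of_forall hg0) hg.aemeasurable]
  have hset : ∀ t : ℝ, MeasurableSet {a : E | t < g a} := fun t =>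
    measurableSet_lt measurable_const hg
  have hsplit : Ioi (0 : ℝ) = Ioc 0 1 ∪ Ioi 1 := (Ioc_union_Ioi_eq_Ioi zero_le_one).symm
  calc ∫⁻ t in Ioi 0, p {a | t < g a}
      ≤ (∫⁻ t in Ioc 0 1, p {a | t < g a}) + ∫⁻ t in Ioi 1, p {a | t < g a} := by
        rw [hsplit]; exact lintegral_union_le _ _ _
    _ = ∫⁻ t in Ioc 0 1, p {a | t < g a} := by
        rw [setLIntegral_congr_fun measurableSet_Ioi
          (fun t (ht : t ∈ Ioi (1:ℝ)) => by
            show p {a | t < g a} = (fun _ => (0 : ℝ≥0∞)) t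
            rw [setOf_lt_eq_empty hg1 (le_of_lt ht), measure_empty]),
          lintegral_zero, add_zero]
    _ ≤ ∫⁻ t in Ioc 0 1, (q {a | t < g a} + ENNReal.ofReal c) :=
        lintegral_mono fun t => hA _ (hset t)
    _ = (∫⁻ t in Ioc 0 1, q {a | t < g a}) + ENNReal.ofReal c * volume (Ioc (0 : ℝ) 1) := by
        rw [lintegral_add_right _ measurable_const, setLIntegral_const]
    _ ≤ (∫⁻ t in Ioi 0, q {a | t < g a}) + ENNReal.ofReal c := by
        rw [Real.volume_Ioc, sub_zero, ENNReal.ofReal_one, mul_one]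
        exact add_le_add (lintegral_mono_set Ioc_subset_Ioi_self) le_rfl

/-- A total-variation estimate `p A ≤ q A + c` bounds the difference of integrals of a function with oscillation `δ` by `δ * c`. -/
theorem integral_le_of_tv {p q : Measure E} [IsProbabilityMeasure p] [IsProbabilityMeasure q]
    {c : ℝ} (hc0 : 0 ≤ c) (hc : ∀ A, MeasurableSet A → (p A).toReal ≤ (q A).toReal + c)
    {h : E → ℝ} (hh : Measurable h) {m δ : ℝ} (hδ : 0 ≤ δ) (hlo : ∀ w, m ≤ h w)
    (hhi : ∀ w, h w ≤ m + δ) :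
    ∫ w, h w ∂p ≤ ∫ w, h w ∂q + δ * c := by
  rcases hδ.eq_or_lt with hδ0 | hδpos
  · have hconst : ∀ w, h w = m := fun w =>
      le_antisymm (by have := hhi w; rw [← hδ0, add_zero] at this; exact this) (hlo w)
    have hfun : h = fun _ => m := funext hconst
    rw [hfun, integral_const, integral_const, probReal_univ, probReal_univ, ← hδ0, zero_mul, add_zero]
  · set g : E → ℝ := fun w => (h w - m) / δ with hg
    have hgm : Measurable g := (hh.sub_const m).div_const δ
    have hg0 : ∀ w, 0 ≤ g w := fun w => div_nonneg (sub_nonneg.2 (hlo w)) hδ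
    have hg1 : ∀ w, g w ≤ 1 := fun w => (div_le_one hδpos).2 (by linarith [hhi w])
    have key := lintegral_le_of_tv hc0 hc hgm hg0 hg1 (p := p) (q := q)
    have hgi : ∀ (ν : Measure E) [IsProbabilityMeasure ν], Integrable g ν := fun ν _ =>
      (integrable_const (1 : ℝ)).mono' hgm.aestronglyMeasurable
        (Filter.Eventually.of_forall fun w => by
          rw [Real.norm_eq_abs, abs_of_nonneg (hg0 w)]; exact hg1 w)
    have hfin : ∀ (ν : Measure E) [IsProbabilityMeasure ν], ∫⁻ w, ENNReal.ofReal (g w) ∂ν ≠ ⊤ := by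
      intro ν _
      refine ne_top_of_le_ne_top ENNReal.one_ne_top ?_
      calc ∫⁻ w, ENNReal.ofReal (g w) ∂ν ≤ ∫⁻ _, 1 ∂ν :=
            lintegral_mono fun w => ENNReal.ofReal_le_one.2 (hg1 w)
        _ = 1 := by rw [lintegral_const, measure_univ, mul_one]
    have h1 : ∫ w, g w ∂p ≤ ∫ w, g w ∂q + c := by
      rw [integral_eq_lintegral_of_nonneg_ae (Filter.Eventually.of_forall hg0) hgm.aestronglyMeasurable,
        integral_eq_lintegral_of_nonneg_ae (Filter.Eventually.of_forall hg0) hgm.aestronglyMeasurable]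
      calc (∫⁻ w, ENNReal.ofReal (g w) ∂p).toReal
          ≤ (∫⁻ w, ENNReal.ofReal (g w) ∂q + ENNReal.ofReal c).toReal :=
            ENNReal.toReal_mono (ENNReal.add_ne_top.2 ⟨hfin q, ENNReal.ofReal_ne_top⟩) key
        _ = (∫⁻ w, ENNReal.ofReal (g w) ∂q).toReal + c := by
            rw [ENNReal.toReal_add (hfin q) ENNReal.ofReal_ne_top, ENNReal.toReal_ofReal hc0]
    have hh' : ∀ w, h w = m + δ * g w := fun w => by
      rw [hg]; field_simp; ring
    have heq : ∀ (ν : Measure E) [IsProbabilityMeasure ν], ∫ w, h w ∂ν = m + δ * ∫ w, g w ∂ν := by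
      intro ν _
      simp_rw [hh']
      rw [integral_add (integrable_const m) ((hgi ν).const_mul δ), integral_const, probReal_univ,
        one_smul, integral_const_mul]
    rw [heq p, heq q]
    nlinarith [h1, hδpos]

/-! ### The one-site operator: boundedness, measurability, locality -/

variable (K : Fin (n + 1) → Kernel (Fin (n + 1) → E) E) [∀ i, IsMarkovKernel (K i)]

/-- The single-site operator `siteOp K i` preserves the uniform bound `|f| ≤ M`. -/
theorem abs_siteOp_le {f : (Fin (n + 1) → E) → ℝ} {M : ℝ} (hfM : ∀ z, |f z| ≤ M)
    (i : Fin (n + 1)) (z : Fin (n + 1) → E) : |siteOp K i f z| ≤ M := by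
  have hM : 0 ≤ M := (abs_nonneg _).trans (hfM z)
  unfold siteOp
  have h := norm_integral_le_of_norm_le_const (μ := K i z) (f := fun y => f (update z i y))
    (Filter.Eventually.of_forall fun y => (hfM (update z i y) : ‖f (update z i y)‖ ≤ M))
  rw [Real.norm_eq_abs] at h
  simpa using h

/-- The single-site operator `siteOp K i` preserves measurability. -/
theorem measurable_siteOp {f : (Fin (n + 1) → E) → ℝ} (hf : Measurable f) (i : Fin (n + 1)) :
    Measurable (siteOp K i f) := by
  have h1 : Measurable fun p : (Fin (n + 1) → E) × E => f (update p.1 i p.2) :=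
    hf.comp measurable_update'
  have h2 := h1.stronglyMeasurable.integral_kernel_prod_right' (κ := K i)
  exact h2.measurable

/-- A bounded measurable function is integrable against a finite measure. -/
theorem integrable_of_bounded {ν : Measure (Fin (n + 1) → E)} [IsFiniteMeasure ν]
    {f : (Fin (n + 1) → E) → ℝ} (hf : Measurable f) {M : ℝ} (hfM : ∀ z, |f z| ≤ M) :
    Integrable f ν :=
  (integrable_const M).mono' hf.aestronglyMeasurable
    (Filter.Eventually.of_forall fun z => (hfM z : ‖f z‖ ≤ M))

/-- A bounded measurable `f` is integrable along the `i`-th coordinate fibre against `K i z`. -/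
theorem integrable_site {f : (Fin (n + 1) → E) → ℝ} (hf : Measurable f) {M : ℝ}
    (hfM : ∀ z, |f z| ≤ M) (i : Fin (n + 1)) (z : Fin (n + 1) → E) :
    Integrable (fun y => f (update z i y)) (K i z) :=
  (integrable_const M).mono' (hf.comp (measurable_update z (a := i))).aestronglyMeasurable
    (Filter.Eventually.of_forall fun y => (hfM (update z i y) : ‖f (update z i y)‖ ≤ M))

variable {K}

omit [∀ i, IsMarkovKernel (K i)] in
/-- Locality of the one-site operator (from locality of the kernel). -/
theorem siteOp_update (hloc : ∀ i (z : Fin (n + 1) → E) (y : E), K i (update z i y) = K i z)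
    (i : Fin (n + 1)) (f : (Fin (n + 1) → E) → ℝ) (z : Fin (n + 1) → E) (y : E) :
    siteOp K i f (update z i y) = siteOp K i f z := by
  unfold siteOp
  rw [hloc i z y]
  simp_rw [update_idem]

omit [∀ i, IsMarkovKernel (K i)] in
/-- `osc_i (P_i f) = 0` (as an upper bound). -/
theorem osc_siteOp_self (hloc : ∀ i (z : Fin (n + 1) → E) (y : E), K i (update z i y) = K i z)
    (i : Fin (n + 1)) (f : (Fin (n + 1) → E) → ℝ) : osc i (siteOp K i f) ≤ 0 :=
  osc_le le_rfl fun z y y' => by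
    rw [siteOp_update hloc, siteOp_update hloc, sub_self, abs_zero]

/-- Dobrushin's one-step comparison: `osc_j (P_i f) ≤ osc_j f + c_ij · osc_i f` for `j ≠ i`. -/
theorem osc_siteOp_le
    {c : Fin (n + 1) → Fin (n + 1) → ℝ} (hc0 : ∀ i j, 0 ≤ c i j)
    (hTV : ∀ i j (z : Fin (n + 1) → E) (y : E) (A : Set E), MeasurableSet A →
      ((K i z) A).toReal ≤ ((K i (update z j y)) A).toReal + c i j)
    {f : (Fin (n + 1) → E) → ℝ} (hf : Measurable f) {M : ℝ} (hfM : ∀ z, |f z| ≤ M)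
    {i j : Fin (n + 1)} (hij : j ≠ i) :
    osc j (siteOp K i f) ≤ osc j f + c i j * osc i f := by
  have hE : Nonempty E ∨ IsEmpty E := by
    rcases isEmpty_or_nonempty E with h | h
    · exact Or.inr h
    · exact Or.inl h
  refine osc_le (add_nonneg (osc_nonneg j f) (mul_nonneg (hc0 i j) (osc_nonneg i f))) ?_
  intro z y y'
  -- one-sided bound, for an arbitrary ordered pair
  have one : ∀ y y' : E, siteOp K i f (update z j y) - siteOp K i f (update z j y') ≤
      osc j f + c i j * osc i f := by
    intro y y'
    haveI : Nonempty E := ⟨y⟩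
    set zy := update z j y with hzy
    set zy' := update z j y' with hzy'
    -- step A : same kernel, different integrands
    have hA : ∫ w, f (update zy i w) ∂(K i zy) - ∫ w, f (update zy' i w) ∂(K i zy) ≤ osc j f := by
      rw [← integral_sub (integrable_site K hf hfM i zy) ?_]
      · have hb : ∀ w, f (update zy i w) - f (update zy' i w) ≤ osc j f := by
          intro w
          have h1 : update zy i w = update (update z i w) j y := by
            rw [hzy, update_comm hij]
          have h2 : update zy' i w = update (update z i w) j y' := by
            rw [hzy', update_comm hij]
          rw [h1, h2]
          exact (le_abs_self _).trans (abs_sub_le_osc hfM j _ y y')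
        calc ∫ w, f (update zy i w) - f (update zy' i w) ∂(K i zy)
            ≤ ∫ _, osc j f ∂(K i zy) := integral_mono ((integrable_site K hf hfM i zy).sub ?_)
                (integrable_const _) hb
          _ = osc j f := by rw [integral_const, probReal_univ, one_smul]
        exact (integrable_const M).mono'
          (hf.comp ((measurable_update zy' (a := i)))).aestronglyMeasurable
          (Filter.Eventually.of_forall fun w => (hfM _ : ‖f (update zy' i w)‖ ≤ M))
      · exact (integrable_const M).mono'
          (hf.comp ((measurable_update zy' (a := i)))).aestronglyMeasurable
          (Filter.Eventually.of_forall fun w => (hfM _ : ‖f (update zy' i w)‖ ≤ M))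
    -- step B : same integrand, kernels at `zy` and `zy' = update zy j y'`
    have hB : ∫ w, f (update zy' i w) ∂(K i zy) - ∫ w, f (update zy' i w) ∂(K i zy') ≤
        osc i f * c i j := by
      set h : E → ℝ := fun w => f (update zy' i w) with hh
      have hhm : Measurable h := hf.comp (measurable_update zy' (a := i))
      set m : ℝ := ⨅ w, h w with hm
      have hbdd : BddBelow (Set.range h) := ⟨-M, by rintro _ ⟨w, rfl⟩; exact (abs_le.1 (hfM _)).1⟩
      have hlo : ∀ w, m ≤ h w := fun w => ciInf_le hbdd w
      have hhi : ∀ w, h w ≤ m + osc i f := by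
        intro w
        have : ∀ w', h w - osc i f ≤ h w' := fun w' => by
          have := abs_sub_le_osc hfM i zy' w w'
          rw [abs_le] at this
          show f (update zy' i w) - osc i f ≤ f (update zy' i w')
          linarith [this.2]
        linarith [le_ciInf this]
      have hzz : zy' = update zy j y' := by rw [hzy, hzy', update_idem]
      have htv : ∀ A, MeasurableSet A → ((K i zy) A).toReal ≤ ((K i zy') A).toReal + c i j := by
        intro A hA; rw [hzz]; exact hTV i j zy y' A hA
      have := integral_le_of_tv (hc0 i j) htv hhm (osc_nonneg i f) hlo hhi
      linarith
    have : siteOp K i f zy - siteOp K i f zy' =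
        (∫ w, f (update zy i w) ∂(K i zy) - ∫ w, f (update zy' i w) ∂(K i zy)) +
        (∫ w, f (update zy' i w) ∂(K i zy) - ∫ w, f (update zy' i w) ∂(K i zy')) := by
      unfold siteOp; ring
    rw [this]
    nlinarith [hA, hB, hc0 i j, osc_nonneg i f]
  rw [abs_le]
  constructor
  · have := one y' y
    linarith
  · exact one y y'


/-! ### Dobrushin's contraction of the total oscillation under the random-scan operator -/

variable (K) in
/-- The averaged scan operator `scanOp K` preserves the uniform bound `|f| ≤ M`. -/
theorem abs_scanOp_le {f : (Fin (n + 1) → E) → ℝ} {M : ℝ} (hfM : ∀ z, |f z| ≤ M)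
    (z : Fin (n + 1) → E) : |scanOp K f z| ≤ M := by
  have hM : 0 ≤ M := (abs_nonneg _).trans (hfM z)
  unfold scanOp
  rw [abs_mul, abs_of_nonneg (inv_nonneg.2 (by positivity))]
  calc ((n : ℝ) + 1)⁻¹ * |∑ i, siteOp K i f z| ≤ ((n : ℝ) + 1)⁻¹ * ∑ i : Fin (n + 1), M := by
        refine mul_le_mul_of_nonneg_left ((Finset.abs_sum_le_sum_abs _ _).trans
          (Finset.sum_le_sum fun i _ => abs_siteOp_le K hfM i z)) (inv_nonneg.2 (by positivity))
    _ = M := by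
        rw [Finset.sum_const, Finset.card_univ, Fintype.card_fin, nsmul_eq_mul]; push_cast
        field_simp

variable (K) in
/-- The averaged scan operator `scanOp K` preserves measurability. -/
theorem measurable_scanOp {f : (Fin (n + 1) → E) → ℝ} (hf : Measurable f) :
    Measurable (scanOp K f) :=
  (Finset.measurable_sum _ fun i _ => measurable_siteOp K hf i).const_mul _

variable (K) in
/-- The coordinate-`j` oscillation of `scanOp K f` is at most the average of the oscillations of the `siteOp K i f`. -/
theorem osc_scanOp_le {f : (Fin (n + 1) → E) → ℝ} {M : ℝ} (hfM : ∀ z, |f z| ≤ M)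
    (j : Fin (n + 1)) :
    osc j (scanOp K f) ≤ ((n : ℝ) + 1)⁻¹ * ∑ i, osc j (siteOp K i f) := by
  refine osc_le (mul_nonneg (inv_nonneg.2 (by positivity))
    (Finset.sum_nonneg fun i _ => osc_nonneg _ _)) ?_
  intro z y y'
  unfold scanOp
  rw [← mul_sub, ← Finset.sum_sub_distrib, abs_mul, abs_of_nonneg (inv_nonneg.2 (by positivity))]
  refine mul_le_mul_of_nonneg_left ((Finset.abs_sum_le_sum_abs _ _).trans
    (Finset.sum_le_sum fun i _ => ?_)) (inv_nonneg.2 (by positivity))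
  exact abs_sub_le_osc (abs_siteOp_le K hfM i) j z y y'

/-- **Dobrushin's contraction.** `Φ(T f) ≤ ((n + D)/(n + 1)) · Φ(f)` (row-sum condition). -/
theorem Phi_scanOp_le (hloc : ∀ i (z : Fin (n + 1) → E) (y : E), K i (update z i y) = K i z)
    {c : Fin (n + 1) → Fin (n + 1) → ℝ} (hc0 : ∀ i j, 0 ≤ c i j)
    (hTV : ∀ i j (z : Fin (n + 1) → E) (y : E) (A : Set E), MeasurableSet A →
      ((K i z) A).toReal ≤ ((K i (update z j y)) A).toReal + c i j)
    {D : ℝ} (hrow : ∀ i, ∑ j, c i j ≤ D)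
    {f : (Fin (n + 1) → E) → ℝ} (hf : Measurable f) {M : ℝ} (hfM : ∀ z, |f z| ≤ M) :
    Phi (scanOp K f) ≤ ((n : ℝ) + D) / ((n : ℝ) + 1) * Phi f := by
  have hji : ∀ j i, osc j (siteOp K i f) ≤ (if j = i then 0 else osc j f) + c i j * osc i f := by
    intro j i
    by_cases h : j = i
    · subst h
      rw [if_pos rfl, zero_add]
      exact (osc_siteOp_self hloc j f).trans (mul_nonneg (hc0 j j) (osc_nonneg j f))
    · rw [if_neg h]; exact osc_siteOp_le hc0 hTV hf hfM h
  have hA : ∀ j, ∑ i, (if j = i then (0 : ℝ) else osc j f) = n * osc j f := by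
    intro j
    have : ∀ i, (if j = i then (0 : ℝ) else osc j f) = osc j f - (if j = i then osc j f else 0) :=
      fun i => by split_ifs <;> simp
    simp_rw [this]
    rw [Finset.sum_sub_distrib, Finset.sum_const, Finset.card_univ, Fintype.card_fin,
      Finset.sum_ite_eq, if_pos (Finset.mem_univ _), nsmul_eq_mul]
    push_cast; ring
  have hpos : (0 : ℝ) < (n : ℝ) + 1 := by positivity
  unfold Phi
  calc ∑ j, osc j (scanOp K f)
      ≤ ∑ j, ((n : ℝ) + 1)⁻¹ * ∑ i, osc j (siteOp K i f) :=
        Finset.sum_le_sum fun j _ => osc_scanOp_le K hfM j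
    _ = ((n : ℝ) + 1)⁻¹ * ∑ j, ∑ i, osc j (siteOp K i f) := by rw [Finset.mul_sum]
    _ ≤ ((n : ℝ) + 1)⁻¹ * ∑ j, ∑ i, ((if j = i then 0 else osc j f) + c i j * osc i f) := by
        refine mul_le_mul_of_nonneg_left ?_ (inv_nonneg.2 hpos.le)
        exact Finset.sum_le_sum fun j _ => Finset.sum_le_sum fun i _ => hji j i
    _ = ((n : ℝ) + 1)⁻¹ * ((n : ℝ) * ∑ j, osc j f + ∑ i, (∑ j, c i j) * osc i f) := by
        congr 1
        simp_rw [Finset.sum_add_distrib, hA]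
        rw [← Finset.mul_sum, Finset.sum_comm]
        simp_rw [Finset.sum_mul]
    _ ≤ ((n : ℝ) + 1)⁻¹ * ((n : ℝ) * ∑ j, osc j f + ∑ i, D * osc i f) := by
        refine mul_le_mul_of_nonneg_left ?_ (inv_nonneg.2 hpos.le)
        refine add_le_add le_rfl (Finset.sum_le_sum fun i _ => ?_)
        exact mul_le_mul_of_nonneg_right (hrow i) (osc_nonneg i f)
    _ = ((n : ℝ) + D) / ((n : ℝ) + 1) * ∑ j, osc j f := by
        rw [← Finset.mul_sum]; field_simp

end Summit.AtomisticToContinuum.HydrodynamicLimit.Theorems.HardCorePoincareDobrushin.Abstract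

end
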